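import Mathlib
import HarnessLib
import Summits.HubbardSuperconductivity.HubbardSuperconductivity.Theorems.KLProgrammePerturbedFermiCurveLevelTowerFaaDiBruno

/-!
# Route `KLProgramme` — crux C4a, S3 brick (B3)/(B4) interface: FAÀ DI BRUNO SMALL-FACTOR COUNTING for the co-moving integrand
# `θ ↦ J(φ+θ)·Ψ(ē(θ))` — every block of the partition carries one small factor of the partner band's jets

Cell `gate-hubbard-kl`, seat hubbard-kl-k3c3-p3 (g24; row «implicit-function / monotonicity route»).  Located brick «(B3)-ALL-ORDERS» for the
(C)-closer lane (stub (C) `stub_twoLeg_curvature` of `KLRegimeEngineV17F2`, stmt-HubbardSuperconductivity-20437; c4a-1 C4A-PLAN §24.4 / §24.9 (iii) /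
§24.11 «(B3) completion … orders 2–4»).  C4A-PLAN §24.4 prices the base-angle jets of the co-moving bubble by the rule «each `θ`-derivative that falls on
the partner line's propagator `G(ē)` costs one scale but comes with one anisotropy factor `𝒜 = ∂_θ ē` (small near the Cooper and tangency
configurations)».  At order `i` this is Faà di Bruno's formula read term by term: the partition with `L` blocks contributes
`Ψ^{(L)}(ē)·Π_{blocks} ∂_θ^{|block|} ē`, so if EVERY jet of `ē` carries one small factor `α` (`|∂ʲ_θ ē| ≤ α·G j`, the content of the (B2) files),
the `L`-th derivative of `Ψ` is paired with `α^L`.  This module is the carrier-free statement, generic over a real normed space `E` of values: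

* §1 `norm_iteratedDeriv_scomp_le_sum` — `‖(Ψ∘g)⁽ⁿ⁾(x)‖ ≤ Σ_{c : OrderedFinpartition n} ‖Ψ^{(c.length)}(g x)‖·Π_j |g^{(|c_j|)}(x)|`
  (Mathlib's one-dimensional Faà di Bruno `iteratedDeriv_scomp_eq_sum_orderedFinpartition` in norm);
  **`norm_iteratedDeriv_scomp_le_of_small_factor`** — one small factor per block: `… ≤ Σ_c ‖Ψ^{(c.length)}(g x)‖·α^{c.length}·Π_j G |c_j|`;
  `ofpSum_le_factorial_mul` — the crude closed form `Σ_c M(c.length)·α^{c.length}·Π G|c_j| ≤ n!·Dⁿ·Σ_{L=1}^{n} M L·α^L` (`n ≥ 1`, `G j ≤ Dʲ`);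
  **`norm_iteratedDeriv_scomp_le_factorial`** — the two combined.
* §2 the Leibniz layer for the Jacobian weight: `norm_iteratedDeriv_smul_le_sum` (`‖(J•H)⁽ⁿ⁾(x)‖ ≤ Σ_a C(n,a)|J⁽ᵃ⁾(x)|·‖H⁽ⁿ⁻ᵃ⁾(x)‖`, Mathlib's
  `norm_iteratedFDeriv_smul_le` in one dimension), `iteratedDeriv_comp_const_add_apply` (the recentred weight `θ ↦ J(φ+θ)`),
  **`norm_iteratedDeriv_weight_smul_scomp_le`** — the full integrand: `‖∂ⁿ_θ[J(φ+θ)•Ψ(g θ)](x)‖ ≤ Σ_a C(n,a)·Jt a·Σ_{c : OFP(n−a)} ‖Ψ^{(c.length)}(g x)‖·α^{c.length}·Π G|c_j|`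
  from a table `|J⁽ᵃ⁾| ≤ Jt a` and the small-factor hypothesis on `g`.

Everything is PROVED, no definitions, nothing about the Hubbard model (the instantiation on the partner band is `…C4aPartnerBandJetCounting`; the
integrals are `…C4aBubbleTubeDerivAll`).  References: FST II CPAM 51 (1998) §3 (tangential regularity of the two-loop self-energy: the mechanism in prose);
Faà di Bruno's formula [Mathlib `Mathlib.Analysis.Calculus.IteratedDeriv.FaaDiBruno`]; BGM 2006 §2.4 [cite: BenfattoGiulianiMastropietro2006].
-/

noncomputable section

namespace Summit.HubbardSuperconductivity.HubbardSuperconductivity.Theorems.C4a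

set_option linter.dupNamespace false -- summit = problem name (single-conjunct summit), D-0017

open Real Set Finset
open Summit.HubbardSuperconductivity.HubbardSuperconductivity.Theorems.PerturbedFermiCurve

/-! ## §1 Faà di Bruno in norm; one small factor per block -/

section Composite

variable {E : Type*} [NormedAddCommGroup E] [NormedSpace ℝ E]

/-- **Faà di Bruno in norm**: for `Ψ : ℝ → E` of class `Cⁿ` at `g x` and `g : ℝ → ℝ` of class `Cⁿ` at `x`,
`‖(Ψ ∘ g)⁽ⁿ⁾(x)‖ ≤ Σ_{c : OrderedFinpartition n} ‖Ψ^{(c.length)}(g x)‖ · Π_j |g^{(c.partSize j)}(x)|`. [folklore] -/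
theorem norm_iteratedDeriv_scomp_le_sum {Ψ : ℝ → E} {g : ℝ → ℝ} {x : ℝ} {n : ℕ}
    (hΨ : ContDiffAt ℝ n Ψ (g x)) (hg : ContDiffAt ℝ n g x) :
    ‖iteratedDeriv n (Ψ ∘ g) x‖ ≤
      ∑ c : OrderedFinpartition n, ‖iteratedDeriv c.length Ψ (g x)‖ * ∏ j, |iteratedDeriv (c.partSize j) g x| := by
  rw [iteratedDeriv_scomp_eq_sum_orderedFinpartition hΨ hg le_rfl]
  refine (norm_sum_le _ _).trans (Finset.sum_le_sum fun c _ => ?_)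
  rw [norm_smul, mul_comm, Real.norm_eq_abs, Finset.abs_prod]

/-- The same for the composition written as a lambda. -/
theorem norm_iteratedDeriv_fun_scomp_le_sum {Ψ : ℝ → E} {g : ℝ → ℝ} {x : ℝ} {n : ℕ}
    (hΨ : ContDiffAt ℝ n Ψ (g x)) (hg : ContDiffAt ℝ n g x) :
    ‖iteratedDeriv n (fun θ => Ψ (g θ)) x‖ ≤
      ∑ c : OrderedFinpartition n, ‖iteratedDeriv c.length Ψ (g x)‖ * ∏ j, |iteratedDeriv (c.partSize j) g x| :=
  norm_iteratedDeriv_scomp_le_sum hΨ hg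

/-- **ONE SMALL FACTOR PER BLOCK.**  If every jet of `g` at `x` of order `1 ≤ j ≤ n` carries the small factor `α ≥ 0`, `|g⁽ʲ⁾(x)| ≤ α·G j`,
then the Faà di Bruno term with `L` blocks carries `α^L`:
`‖(Ψ ∘ g)⁽ⁿ⁾(x)‖ ≤ Σ_{c} ‖Ψ^{(c.length)}(g x)‖ · (α^{c.length} · Π_j G (c.partSize j))`.
This is C4A-PLAN §24.4's «`𝒜ⁱ` against `G^{(i)}`» at every order. [folklore] -/
theorem norm_iteratedDeriv_scomp_le_of_small_factor {Ψ : ℝ → E} {g : ℝ → ℝ} {x : ℝ} {n : ℕ}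
    (hΨ : ContDiffAt ℝ n Ψ (g x)) (hg : ContDiffAt ℝ n g x) {α : ℝ} {G : ℕ → ℝ}
    (hG : ∀ j, 1 ≤ j → j ≤ n → |iteratedDeriv j g x| ≤ α * G j) :
    ‖iteratedDeriv n (Ψ ∘ g) x‖ ≤
      ∑ c : OrderedFinpartition n, ‖iteratedDeriv c.length Ψ (g x)‖ * (α ^ c.length * ∏ j, G (c.partSize j)) := by
  refine (norm_iteratedDeriv_scomp_le_sum hΨ hg).trans (Finset.sum_le_sum fun c _ => ?_)
  refine mul_le_mul_of_nonneg_left ?_ (norm_nonneg _)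
  calc ∏ j, |iteratedDeriv (c.partSize j) g x| ≤ ∏ j, (α * G (c.partSize j)) :=
        Finset.prod_le_prod (fun j _ => abs_nonneg _) fun j _ => hG _ (c.partSize_pos j) (c.partSize_le j)
    _ = α ^ c.length * ∏ j, G (c.partSize j) := by
        rw [Finset.prod_mul_distrib, Finset.prod_const, Finset.card_univ, Fintype.card_fin]

/-- Lambda form of `norm_iteratedDeriv_scomp_le_of_small_factor`. -/
theorem norm_iteratedDeriv_fun_scomp_le_of_small_factor {Ψ : ℝ → E} {g : ℝ → ℝ} {x : ℝ} {n : ℕ}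
    (hΨ : ContDiffAt ℝ n Ψ (g x)) (hg : ContDiffAt ℝ n g x) {α : ℝ} {G : ℕ → ℝ}
    (hG : ∀ j, 1 ≤ j → j ≤ n → |iteratedDeriv j g x| ≤ α * G j) :
    ‖iteratedDeriv n (fun θ => Ψ (g θ)) x‖ ≤
      ∑ c : OrderedFinpartition n, ‖iteratedDeriv c.length Ψ (g x)‖ * (α ^ c.length * ∏ j, G (c.partSize j)) :=
  norm_iteratedDeriv_scomp_le_of_small_factor hΨ hg hG

/-- At order `0` the Faà di Bruno sum is the value: `Σ_{c : OFP 0} M(c.length)·(α^{c.length}·Π G) = M 0`. [folklore] -/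
theorem ofpSum_zero (M : ℕ → ℝ) (α : ℝ) (G : ℕ → ℝ) :
    ∑ c : OrderedFinpartition 0, M c.length * (α ^ c.length * ∏ j, G (c.partSize j)) = M 0 := by
  rw [Fintype.sum_unique]
  have h0 : (default : OrderedFinpartition 0).length = 0 := le_antisymm (OrderedFinpartition.length_le _) (Nat.zero_le _)
  have hprod : ∏ j : Fin (default : OrderedFinpartition 0).length, G ((default : OrderedFinpartition 0).partSize j) = 1 := by
    have : IsEmpty (Fin (default : OrderedFinpartition 0).length) := by rw [h0]; infer_instance
    exact Finset.prod_of_isEmpty _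
  rw [hprod, h0, pow_zero, mul_one, mul_one]

/-- **The crude closed form of the small-factor sum** (`n ≥ 1`): if `0 ≤ M L` (`1 ≤ L ≤ n`), `0 ≤ α`, `0 ≤ G j ≤ Dʲ` (`1 ≤ j ≤ n`), then
`Σ_{c : OFP n} M(c.length)·(α^{c.length}·Π_j G|c_j|) ≤ n!·Dⁿ·Σ_{L ∈ [1,n]} M L·α^L`
(each product is `≤ D^{Σ|c_j|} = Dⁿ`, each term is one summand of the `L`-sum, at most `n!` partitions). [folklore] -/
theorem ofpSum_le_factorial_mul {n : ℕ} (hn : 1 ≤ n) {M G : ℕ → ℝ} {α D : ℝ} (hα : 0 ≤ α) (hD : 0 ≤ D)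
    (hM : ∀ L, 1 ≤ L → L ≤ n → 0 ≤ M L) (hG0 : ∀ j, 1 ≤ j → j ≤ n → 0 ≤ G j) (hGD : ∀ j, 1 ≤ j → j ≤ n → G j ≤ D ^ j) :
    ∑ c : OrderedFinpartition n, M c.length * (α ^ c.length * ∏ j, G (c.partSize j)) ≤
      n.factorial * D ^ n * ∑ L ∈ Finset.Icc 1 n, M L * α ^ L := by
  classical
  set S : ℝ := ∑ L ∈ Finset.Icc 1 n, M L * α ^ L with hS
  have hS0 : 0 ≤ S := Finset.sum_nonneg fun L hL => by
    have h := Finset.mem_Icc.1 hL; exact mul_nonneg (hM L h.1 h.2) (pow_nonneg hα _)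
  have hterm : ∀ c ∈ (Finset.univ : Finset (OrderedFinpartition n)),
      M c.length * (α ^ c.length * ∏ j, G (c.partSize j)) ≤ D ^ n * S := by
    intro c _
    have hL : 1 ≤ c.length ∧ c.length ≤ n := ⟨c.length_pos hn, c.length_le⟩
    have hps : ∀ j, 1 ≤ c.partSize j ∧ c.partSize j ≤ n := fun j => ⟨c.partSize_pos j, c.partSize_le j⟩
    have hprod : ∏ j, G (c.partSize j) ≤ D ^ n := by
      calc ∏ j, G (c.partSize j) ≤ ∏ j, D ^ c.partSize j :=
            Finset.prod_le_prod (fun j _ => hG0 _ (hps j).1 (hps j).2) fun j _ => hGD _ (hps j).1 (hps j).2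
        _ = D ^ ∑ j, c.partSize j := Finset.prod_pow_eq_pow_sum _ _ _
        _ = D ^ n := by rw [ofp_sum_partSize]
    have hprod0 : 0 ≤ ∏ j, G (c.partSize j) := Finset.prod_nonneg fun j _ => hG0 _ (hps j).1 (hps j).2
    have hone : M c.length * α ^ c.length ≤ S := by
      rw [hS]
      exact Finset.single_le_sum (f := fun L => M L * α ^ L)
        (fun L hL => by have h := Finset.mem_Icc.1 hL; exact mul_nonneg (hM L h.1 h.2) (pow_nonneg hα _))
        (Finset.mem_Icc.2 hL)
    have hMa0 : 0 ≤ M c.length * α ^ c.length := mul_nonneg (hM _ hL.1 hL.2) (pow_nonneg hα _)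
    calc M c.length * (α ^ c.length * ∏ j, G (c.partSize j)) = (M c.length * α ^ c.length) * ∏ j, G (c.partSize j) := by ring
      _ ≤ S * D ^ n := mul_le_mul hone hprod hprod0 hS0
      _ = D ^ n * S := mul_comm _ _
  refine (Finset.sum_le_card_nsmul _ _ _ hterm).trans ?_
  rw [nsmul_eq_mul, Finset.card_univ]
  have hcard : (Fintype.card (OrderedFinpartition n) : ℝ) ≤ n.factorial := by exact_mod_cast card_orderedFinpartition_le_factorial n
  have h0 : 0 ≤ D ^ n * S := mul_nonneg (pow_nonneg hD _) hS0
  calc (Fintype.card (OrderedFinpartition n) : ℝ) * (D ^ n * S) ≤ n.factorial * (D ^ n * S) := mul_le_mul_of_nonneg_right hcard h0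
    _ = n.factorial * D ^ n * S := by ring

/-- **SMALL-FACTOR COUNTING, closed form** (`n ≥ 1`): with `‖Ψ^{(L)}(g x)‖ ≤ M L` (`1 ≤ L ≤ n`), `|g⁽ʲ⁾(x)| ≤ α·G j`, `0 ≤ G j ≤ Dʲ` (`1 ≤ j ≤ n`),
`0 ≤ α`, `0 ≤ D`:  `‖(Ψ ∘ g)⁽ⁿ⁾(x)‖ ≤ n!·Dⁿ·Σ_{L=1}^{n} M L·α^L` — the `L`-th derivative of `Ψ` always comes with `α^L`. [folklore] -/
theorem norm_iteratedDeriv_scomp_le_factorial {Ψ : ℝ → E} {g : ℝ → ℝ} {x : ℝ} {n : ℕ} (hn : 1 ≤ n)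
    (hΨ : ContDiffAt ℝ n Ψ (g x)) (hg : ContDiffAt ℝ n g x) {α D : ℝ} (hα : 0 ≤ α) (hD : 0 ≤ D) {M G : ℕ → ℝ}
    (hM : ∀ L, 1 ≤ L → L ≤ n → ‖iteratedDeriv L Ψ (g x)‖ ≤ M L)
    (hG : ∀ j, 1 ≤ j → j ≤ n → |iteratedDeriv j g x| ≤ α * G j) (hG0 : ∀ j, 1 ≤ j → j ≤ n → 0 ≤ G j)
    (hGD : ∀ j, 1 ≤ j → j ≤ n → G j ≤ D ^ j) :
    ‖iteratedDeriv n (fun θ => Ψ (g θ)) x‖ ≤ n.factorial * D ^ n * ∑ L ∈ Finset.Icc 1 n, M L * α ^ L := by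
  refine (norm_iteratedDeriv_fun_scomp_le_of_small_factor hΨ hg hG).trans ?_
  have hM0 : ∀ L, 1 ≤ L → L ≤ n → 0 ≤ M L := fun L h1 h2 => (norm_nonneg _).trans (hM L h1 h2)
  refine le_trans (Finset.sum_le_sum fun c _ => ?_) (ofpSum_le_factorial_mul hn hα hD hM0 hG0 hGD)
  have hL : 1 ≤ c.length ∧ c.length ≤ n := ⟨c.length_pos hn, c.length_le⟩
  have h0 : 0 ≤ α ^ c.length * ∏ j, G (c.partSize j) :=
    mul_nonneg (pow_nonneg hα _) (Finset.prod_nonneg fun j _ => hG0 _ (c.partSize_pos j) (c.partSize_le j))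
  exact mul_le_mul_of_nonneg_right (hM _ hL.1 hL.2) h0

end Composite

/-! ## §2 The Leibniz layer for the Jacobian weight `θ ↦ J(φ+θ)` -/

section Weight

variable {E : Type*} [NormedAddCommGroup E] [NormedSpace ℝ E]

/-- **Leibniz in norm** for a real weight times a vector function: `‖(J•H)⁽ⁿ⁾(x)‖ ≤ Σ_{a=0}^{n} C(n,a)·|J⁽ᵃ⁾(x)|·‖H⁽ⁿ⁻ᵃ⁾(x)‖`
(Mathlib's `norm_iteratedFDeriv_smul_le` in one dimension). [folklore] -/
theorem norm_iteratedDeriv_smul_le_sum {J : ℝ → ℝ} {H : ℝ → E} {n : ℕ} (hJ : ContDiff ℝ n J) (hH : ContDiff ℝ n H) (x : ℝ) :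
    ‖iteratedDeriv n (fun θ => J θ • H θ) x‖ ≤
      ∑ a ∈ Finset.range (n + 1), (n.choose a : ℝ) * |iteratedDeriv a J x| * ‖iteratedDeriv (n - a) H x‖ := by
  have h := norm_iteratedFDeriv_smul_le (𝕜 := ℝ) hJ hH x (n := n) (by exact_mod_cast le_rfl)
  rw [norm_iteratedFDeriv_eq_norm_iteratedDeriv] at h
  refine h.trans (le_of_eq (Finset.sum_congr rfl fun a _ => ?_))
  rw [norm_iteratedFDeriv_eq_norm_iteratedDeriv, norm_iteratedFDeriv_eq_norm_iteratedDeriv, Real.norm_eq_abs, mul_assoc]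

/-- The jets of the recentred weight: `∂ᵃ_θ[J(φ+θ)](x) = J⁽ᵃ⁾(φ+x)`. [folklore] -/
theorem iteratedDeriv_comp_const_add_apply (J : ℝ → ℝ) (φ x : ℝ) (a : ℕ) :
    iteratedDeriv a (fun θ => J (φ + θ)) x = iteratedDeriv a J (φ + x) := by
  rw [iteratedDeriv_comp_const_add a J φ]

/-- The recentred weight is `Cⁿ` when `J` is. -/
theorem contDiff_comp_const_add {J : ℝ → ℝ} {n : ℕ∞} (hJ : ContDiff ℝ n J) (φ : ℝ) : ContDiff ℝ n fun θ => J (φ + θ) :=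
  hJ.comp (contDiff_const.add contDiff_id)

/-- **Leibniz with a weight table**: `|J⁽ᵃ⁾(s)| ≤ Jt a` for all `s` and `a ≤ n` gives
`‖∂ⁿ_θ[J(φ+θ)•H(θ)](x)‖ ≤ Σ_a C(n,a)·Jt a·‖H⁽ⁿ⁻ᵃ⁾(x)‖`. [folklore] -/
theorem norm_iteratedDeriv_weight_smul_le_sum {J : ℝ → ℝ} {H : ℝ → E} {n : ℕ} (hJ : ContDiff ℝ n J) (hH : ContDiff ℝ n H)
    {Jt : ℕ → ℝ} (hJt : ∀ a ≤ n, ∀ s, |iteratedDeriv a J s| ≤ Jt a) (φ x : ℝ) :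
    ‖iteratedDeriv n (fun θ => J (φ + θ) • H θ) x‖ ≤ ∑ a ∈ Finset.range (n + 1), (n.choose a : ℝ) * Jt a * ‖iteratedDeriv (n - a) H x‖ := by
  refine (norm_iteratedDeriv_smul_le_sum (contDiff_comp_const_add hJ φ) hH x).trans (Finset.sum_le_sum fun a ha => ?_)
  have han : a ≤ n := Nat.lt_succ_iff.1 (Finset.mem_range.1 ha)
  rw [iteratedDeriv_comp_const_add_apply]
  have := hJt a han (φ + x)
  gcongr

/-- **THE CO-MOVING INTEGRAND, small-factor counting at every order.**  Let `J : ℝ → ℝ`, `Ψ : ℝ → E`, `g : ℝ → ℝ` be `Cⁿ` with a weight table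
`|J⁽ᵃ⁾(s)| ≤ Jt a` (`a ≤ n`, all `s`) and ONE SMALL FACTOR PER JET of `g` at `x`: `|g⁽ʲ⁾(x)| ≤ α·G j` (`1 ≤ j ≤ n`).  Then
`‖∂ⁿ_θ[J(φ+θ)•Ψ(g θ)](x)‖ ≤ Σ_{a=0}^{n} C(n,a)·Jt a·Σ_{c : OFP (n−a)} ‖Ψ^{(c.length)}(g x)‖·(α^{c.length}·Π_j G|c_j|)`:
the term where `L` derivatives reach `Ψ` carries `α^L` (and `a = n`, no derivative on `Ψ∘g`, is the value term `Jt n·‖Ψ(g x)‖`). [folklore] -/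
theorem norm_iteratedDeriv_weight_smul_scomp_le {J : ℝ → ℝ} {Ψ : ℝ → E} {g : ℝ → ℝ} {n : ℕ}
    (hJ : ContDiff ℝ n J) (hΨ : ContDiff ℝ n Ψ) (hg : ContDiff ℝ n g)
    {Jt : ℕ → ℝ} (hJt : ∀ a ≤ n, ∀ s, |iteratedDeriv a J s| ≤ Jt a) {α : ℝ} {G : ℕ → ℝ} {x : ℝ}
    (hG : ∀ j, 1 ≤ j → j ≤ n → |iteratedDeriv j g x| ≤ α * G j) (φ : ℝ) :
    ‖iteratedDeriv n (fun θ => J (φ + θ) • Ψ (g θ)) x‖ ≤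
      ∑ a ∈ Finset.range (n + 1), (n.choose a : ℝ) * Jt a *
        ∑ c : OrderedFinpartition (n - a), ‖iteratedDeriv c.length Ψ (g x)‖ * (α ^ c.length * ∏ j, G (c.partSize j)) := by
  have hH : ContDiff ℝ n (fun θ => Ψ (g θ)) := hΨ.comp hg
  refine (norm_iteratedDeriv_weight_smul_le_sum hJ hH hJt φ x).trans (Finset.sum_le_sum fun a ha => ?_)
  have han : a ≤ n := Nat.lt_succ_iff.1 (Finset.mem_range.1 ha)
  have hJt0 : 0 ≤ Jt a := (abs_nonneg _).trans (hJt a han 0)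
  have hmono : ‖iteratedDeriv (n - a) (fun θ => Ψ (g θ)) x‖ ≤
      ∑ c : OrderedFinpartition (n - a), ‖iteratedDeriv c.length Ψ (g x)‖ * (α ^ c.length * ∏ j, G (c.partSize j)) := by
    refine norm_iteratedDeriv_fun_scomp_le_of_small_factor
      ((hΨ.of_le (by exact_mod_cast Nat.sub_le n a)).contDiffAt) ((hg.of_le (by exact_mod_cast Nat.sub_le n a)).contDiffAt) ?_
    exact fun j hj1 hj2 => hG j hj1 (hj2.trans (Nat.sub_le n a))
  have hc0 : (0 : ℝ) ≤ (n.choose a : ℝ) * Jt a := mul_nonneg (Nat.cast_nonneg _) hJt0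
  exact mul_le_mul_of_nonneg_left hmono hc0

/-- **Closed form of the integrand counting** (the value term `a = n`, plus the orders `a < n` where at least one derivative reaches `Ψ∘g`):
with `‖Ψ^{(L)}(g x)‖ ≤ M L` (`0 ≤ L ≤ n`), `0 ≤ α`, `0 ≤ G j ≤ Dʲ`, `0 ≤ D`:
`‖∂ⁿ_θ[J(φ+θ)•Ψ(g θ)](x)‖ ≤ Jt n·M 0 + Σ_{a=0}^{n−1} C(n,a)·Jt a·(n−a)!·D^{n−a}·Σ_{L=1}^{n−a} M L·α^L`. [folklore] -/
theorem norm_iteratedDeriv_weight_smul_scomp_le_factorial {J : ℝ → ℝ} {Ψ : ℝ → E} {g : ℝ → ℝ} {n : ℕ}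
    (hJ : ContDiff ℝ n J) (hΨ : ContDiff ℝ n Ψ) (hg : ContDiff ℝ n g)
    {Jt : ℕ → ℝ} (hJt : ∀ a ≤ n, ∀ s, |iteratedDeriv a J s| ≤ Jt a) {α D : ℝ} (hα : 0 ≤ α) (hD : 0 ≤ D) {M G : ℕ → ℝ} {x : ℝ}
    (hM : ∀ L ≤ n, ‖iteratedDeriv L Ψ (g x)‖ ≤ M L)
    (hG : ∀ j, 1 ≤ j → j ≤ n → |iteratedDeriv j g x| ≤ α * G j) (hG0 : ∀ j, 1 ≤ j → j ≤ n → 0 ≤ G j)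
    (hGD : ∀ j, 1 ≤ j → j ≤ n → G j ≤ D ^ j) (φ : ℝ) :
    ‖iteratedDeriv n (fun θ => J (φ + θ) • Ψ (g θ)) x‖ ≤
      Jt n * M 0 + ∑ a ∈ Finset.range n, (n.choose a : ℝ) * Jt a *
        ((n - a).factorial * D ^ (n - a) * ∑ L ∈ Finset.Icc 1 (n - a), M L * α ^ L) := by
  refine (norm_iteratedDeriv_weight_smul_scomp_le hJ hΨ hg hJt hG φ).trans ?_
  rw [Finset.sum_range_succ]
  have hM0 : ∀ L ≤ n, 0 ≤ M L := fun L hL => (norm_nonneg _).trans (hM L hL)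
  -- the value term `a = n`
  have htop : (n.choose n : ℝ) * Jt n *
      ∑ c : OrderedFinpartition (n - n), ‖iteratedDeriv c.length Ψ (g x)‖ * (α ^ c.length * ∏ j, G (c.partSize j)) ≤ Jt n * M 0 := by
    rw [Nat.choose_self, Nat.cast_one, one_mul, Nat.sub_self,
      ofpSum_zero (fun L => ‖iteratedDeriv L Ψ (g x)‖) α G]
    have hJt0 : 0 ≤ Jt n := (abs_nonneg _).trans (hJt n le_rfl 0)
    simpa only [iteratedDeriv_zero] using mul_le_mul_of_nonneg_left (hM 0 (Nat.zero_le _)) hJt0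
  -- the orders `a < n`
  have hrest : ∀ a ∈ Finset.range n, (n.choose a : ℝ) * Jt a *
      ∑ c : OrderedFinpartition (n - a), ‖iteratedDeriv c.length Ψ (g x)‖ * (α ^ c.length * ∏ j, G (c.partSize j)) ≤
      (n.choose a : ℝ) * Jt a * ((n - a).factorial * D ^ (n - a) * ∑ L ∈ Finset.Icc 1 (n - a), M L * α ^ L) := by
    intro a ha
    have han : a < n := Finset.mem_range.1 ha
    have hna : 1 ≤ n - a := by omega
    have hJt0 : 0 ≤ Jt a := (abs_nonneg _).trans (hJt a han.le 0)
    refine mul_le_mul_of_nonneg_left ?_ (mul_nonneg (Nat.cast_nonneg _) hJt0)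
    refine le_trans (Finset.sum_le_sum fun c _ => ?_)
      (ofpSum_le_factorial_mul hna hα hD (fun L _ hL2 => hM0 L (hL2.trans (Nat.sub_le n a)))
        (fun j hj1 hj2 => hG0 j hj1 (hj2.trans (Nat.sub_le n a))) (fun j hj1 hj2 => hGD j hj1 (hj2.trans (Nat.sub_le n a))))
    have h0 : 0 ≤ α ^ c.length * ∏ j, G (c.partSize j) :=
      mul_nonneg (pow_nonneg hα _) (Finset.prod_nonneg fun j _ =>
        hG0 _ (c.partSize_pos j) ((c.partSize_le j).trans (Nat.sub_le n a)))
    exact mul_le_mul_of_nonneg_right (hM _ (c.length_le.trans (Nat.sub_le n a))) h0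
  have := Finset.sum_le_sum hrest
  linarith

end Weight

end Summit.HubbardSuperconductivity.HubbardSuperconductivity.Theorems.C4a

end
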